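import Literature.NumberTheory.Sieve.TwistedWeightSmoothSum
import Mathlib.NumberTheory.EulerProduct.DirichletLSeries
import HarnessLib

/-!
# Character-twisted smooth weighted sums: the Mellin representation and the decay of `L(s, χ; y)`

Topic `Literature/NumberTheory/Sieve`; a PROVED tool file toward
`Literature.NumberTheory.DiophantineGeometry.XYZUpperHalf` ([Harper2016, Cor. 1], the non-principal
characters on the major arcs). For a Dirichlet character `χ (mod q)` put
`L(s, χ; y) = ∏_{p ≤ y} (1 − χ(p) p^{−s})⁻¹ = ∑_{n ∈ S(y)} χ(n) n^{−s}` (`smoothLC`, `Re s > 0`). Then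

* `sum_char_twistWeight_eq_integral`: for `x > 0`, `σ > 0`,
  `∑_{n ∈ S(x,y)} χ(n) W_λ(n/x) = (2π)⁻¹ ∫ x^{σ+it} Ŵ_λ(σ+it) L(σ+it, χ; y) dt`
  (exactly as `TwistedWeight.sum_twistWeight_eq_integral`, with the bounded completely
  multiplicative twist `χ`);
* `norm_smoothLC_le_mul_exp`: for `σ ≥ 3/5`,
  `‖L(σ+it, χ; y)‖ ≤ ζ(σ, y) exp(−(1/5) ∑_{p ≤ y} p^{−σ} (1 − Re(χ(p) p^{−it})))`
  (`‖1 − a z‖ ≥ 1 − a Re z` for `|z| ≤ 1`, `0 ≤ a ≤ 2/3`).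

## References

* A. Hildebrand, G. Tenenbaum, Trans. AMS 296 (1986), §3 (Lemma 8) [HildebrandTenenbaum1986].
* A. J. Harper, Compositio Math. 152 (2016), §2.2, Appendix [Harper2016].
-/

noncomputable section

open Real Complex MeasureTheory Set Filter
open scoped FourierTransform Topology

namespace Literature.NumberTheory.Sieve

namespace TwistedWeight

variable {q : ℕ}

/-! ### `L(s, χ; y)` -/

/-- `L(s, χ; y) = ∏_{p ≤ y} (1 − χ(p) p^{−s})⁻¹`. [cite: Harper2016, §2.2] -/
def smoothLC (χ : DirichletCharacter ℂ q) (s : ℂ) (y : ℕ) : ℂ :=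
  ∏ p ∈ Nat.primesLE y, (1 - χ (p : ZMod q) * (p : ℂ) ^ (-s))⁻¹

/-- **`L(s, χ; y) = ∑_{n ∈ S(y)} χ(n) n^{−s}` for `Re s > 0`** (Euler product over the smooth numbers).
[cite: Harper2016, §2.2] -/
theorem hasSum_smoothLC (χ : DirichletCharacter ℂ q) {s : ℂ} (hs : 0 < s.re) (y : ℕ) :
    HasSum (fun n : ℕ => (Nat.smoothNumbers (y + 1)).indicator
      (fun m : ℕ => χ (m : ZMod q) * (m : ℂ) ^ (-s)) n) (smoothLC χ s y) := by
  have hs0 : s ≠ 0 := fun h => by rw [h] at hs; simp at hs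
  set f : ℕ →* ℂ := (dirichletSummandHom χ hs0).toMonoidHom with hf
  have hfp : ∀ n : ℕ, f n = χ (n : ZMod q) * (n : ℂ) ^ (-s) := fun n => rfl
  have hlt : ∀ {p : ℕ}, p.Prime → ‖f p‖ < 1 := by
    intro p hp
    rw [hfp, norm_mul, Complex.norm_natCast_cpow_of_pos hp.pos]
    have hp1 : (1 : ℝ) < p := by exact_mod_cast hp.one_lt
    have h1 : ‖χ (p : ZMod q)‖ ≤ 1 := DirichletCharacter.norm_le_one χ _
    have h2 : (p : ℝ) ^ (-s).re < 1 := by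
      simp only [Complex.neg_re]
      exact Real.rpow_lt_one_of_one_lt_of_neg hp1 (by linarith)
    calc ‖χ (p : ZMod q)‖ * (p : ℝ) ^ (-s).re ≤ 1 * (p : ℝ) ^ (-s).re :=
          mul_le_mul_of_nonneg_right h1 (by positivity)
      _ < 1 := by rw [one_mul]; exact h2
  have h := (EulerProduct.summable_and_hasSum_smoothNumbers_prod_primesBelow_geometric hlt (y + 1)).2
  rw [← hasSum_subtype_iff_indicator]
  have heq : smoothLC χ s y = ∏ p ∈ (y + 1).primesBelow, (1 - f p)⁻¹ := by
    rw [smoothLC, Nat.primesLE]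
    simp only [hfp]
  rw [heq]
  exact h

/-- Summability of `n ↦ 1_{S(y)}(n) ‖χ(n) n^{−s}‖`, dominated by the `ζ(σ, y)` series. [folklore] -/
theorem summable_norm_char_term (χ : DirichletCharacter ℂ q) {σ : ℝ} (hσ : 0 < σ) (y : ℕ) :
    Summable fun n : ℕ => ‖(Nat.smoothNumbers (y + 1)).indicator
      (fun m : ℕ => χ (m : ZMod q) * (m : ℂ) ^ (-(σ : ℂ))) n‖ := by
  have hsum : Summable fun n : ℕ => ‖LSeries.term (smoothIndicator y) (σ : ℂ) n‖ :=
    (LSeriesSummable_smoothIndicator (s := (σ : ℂ)) (by simp; exact hσ) y).norm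
  refine Summable.of_nonneg_of_le (fun n => norm_nonneg _) (fun n => ?_) hsum
  rw [term_smoothIndicator]
  by_cases hn : n ∈ Nat.smoothNumbers (y + 1)
  · rw [Set.indicator_of_mem hn, Set.indicator_of_mem hn, norm_mul]
    calc ‖χ (n : ZMod q)‖ * ‖(n : ℂ) ^ (-(σ : ℂ))‖ ≤ 1 * ‖(n : ℂ) ^ (-(σ : ℂ))‖ :=
          mul_le_mul_of_nonneg_right (DirichletCharacter.norm_le_one χ _) (norm_nonneg _)
      _ = _ := one_mul _
  · rw [Set.indicator_of_notMem hn, Set.indicator_of_notMem hn]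

/-! ### The Mellin terms -/

/-- `F_n(t) = (2π)⁻¹ 1_{S(y)}(n) χ(n) (n/x)^{−(σ+it)} Ŵ_λ(σ+it)`. [folklore] -/
def charMellinTerm (x σ : ℝ) (y : ℕ) (χ : DirichletCharacter ℂ q) (lam : ℝ) (n : ℕ) (t : ℝ) : ℂ :=
  (1 / (2 * π) : ℝ) • ((Nat.smoothNumbers (y + 1)).indicator
    (fun m : ℕ => χ (m : ZMod q) * (((m / x : ℝ)) : ℂ) ^ (-((σ : ℂ) + t * I))) n * twistMellin lam (σ + t * I))

/-- `F_n = χ(n) · (the untwisted term)`. [folklore] -/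
theorem charMellinTerm_eq (x σ : ℝ) (y : ℕ) (χ : DirichletCharacter ℂ q) (lam : ℝ) (n : ℕ) (t : ℝ) :
    charMellinTerm x σ y χ lam n t = χ (n : ZMod q) * mellinTerm x σ y lam n t := by
  unfold charMellinTerm mellinTerm
  by_cases hn : n ∈ Nat.smoothNumbers (y + 1)
  · simp only [Set.indicator_of_mem hn, Complex.real_smul]
    ring
  · simp only [Set.indicator_of_notMem hn, zero_mul, smul_zero, mul_zero]

/-- `∫ F_n = 1_{S(y)}(n) χ(n) W_λ(n/x)`. [folklore] -/
theorem integral_charMellinTerm {x σ : ℝ} (hx : 0 < x) (hσ : 0 < σ) (y : ℕ) (χ : DirichletCharacter ℂ q)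
    (lam : ℝ) (n : ℕ) :
    ∫ t : ℝ, charMellinTerm x σ y χ lam n t =
      (Nat.smoothNumbers (y + 1)).indicator (fun m : ℕ => χ (m : ZMod q) * twistWeight lam (m / x)) n := by
  simp_rw [charMellinTerm_eq]
  rw [integral_const_mul, integral_mellinTerm hx hσ y lam n]
  by_cases hn : n ∈ Nat.smoothNumbers (y + 1)
  · simp only [Set.indicator_of_mem hn]
  · simp only [Set.indicator_of_notMem hn, mul_zero]

/-- Each `F_n` is integrable. [folklore] -/
theorem integrable_charMellinTerm {x σ : ℝ} (hx : 0 < x) (hσ : 0 < σ) (y : ℕ) (χ : DirichletCharacter ℂ q)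
    (lam : ℝ) (n : ℕ) : Integrable (charMellinTerm x σ y χ lam n) := by
  have h := (integrable_mellinTerm hx hσ y lam n).const_mul (χ (n : ZMod q))
  refine h.congr (Eventually.of_forall fun t => ?_)
  simp only [charMellinTerm_eq]

/-- `∫ ‖F_n‖ ≤ ∫ ‖untwisted F_n‖`. [folklore] -/
theorem integral_norm_charMellinTerm_le {x σ : ℝ} (hx : 0 < x) (hσ : 0 < σ) (y : ℕ)
    (χ : DirichletCharacter ℂ q) (lam : ℝ) (n : ℕ) :
    ∫ t : ℝ, ‖charMellinTerm x σ y χ lam n t‖ ≤ ∫ t : ℝ, ‖mellinTerm x σ y lam n t‖ := by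
  refine integral_mono_of_nonneg (Eventually.of_forall fun t => norm_nonneg _)
    (integrable_mellinTerm hx hσ y lam n).norm (Eventually.of_forall fun t => ?_)
  simp only [charMellinTerm_eq, norm_mul]
  calc ‖χ (n : ZMod q)‖ * ‖mellinTerm x σ y lam n t‖ ≤ 1 * ‖mellinTerm x σ y lam n t‖ :=
        mul_le_mul_of_nonneg_right (DirichletCharacter.norm_le_one χ _) (norm_nonneg _)
    _ = _ := one_mul _

/-- `n ↦ ∫ ‖F_n‖` is summable. [folklore] -/
theorem summable_integral_norm_charMellinTerm {x σ : ℝ} (hx : 0 < x) (hσ : 0 < σ) (y : ℕ)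
    (χ : DirichletCharacter ℂ q) (lam : ℝ) :
    Summable fun n : ℕ => ∫ t : ℝ, ‖charMellinTerm x σ y χ lam n t‖ :=
  Summable.of_nonneg_of_le (fun _ => integral_nonneg fun _ => norm_nonneg _)
    (fun n => integral_norm_charMellinTerm_le hx hσ y χ lam n) (summable_integral_norm_mellinTerm hx hσ y lam)

/-- The finite sum as a `HasSum`. [folklore] -/
theorem hasSum_char_twistWeight {x : ℝ} (hx : 0 < x) (y : ℕ) (χ : DirichletCharacter ℂ q) (lam : ℝ) :
    HasSum (fun n : ℕ => (Nat.smoothNumbers (y + 1)).indicator (fun m : ℕ => χ (m : ZMod q) * twistWeight lam (m / x)) n)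
      (∑ n ∈ Nat.smoothNumbersUpTo ⌊x⌋₊ (y + 1), χ (n : ZMod q) * twistWeight lam (n / x)) := by
  have h1 : ∑ n ∈ Nat.smoothNumbersUpTo ⌊x⌋₊ (y + 1), χ (n : ZMod q) * twistWeight lam (n / x) =
      ∑ n ∈ Nat.smoothNumbersUpTo ⌊x⌋₊ (y + 1),
        (Nat.smoothNumbers (y + 1)).indicator (fun m : ℕ => χ (m : ZMod q) * twistWeight lam (m / x)) n := by
    refine Finset.sum_congr rfl fun n hn => ?_
    rw [Nat.mem_smoothNumbersUpTo] at hn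
    rw [Set.indicator_of_mem hn.2]
  rw [h1]
  refine hasSum_sum_of_ne_finset_zero fun n hn => ?_
  by_cases hS : n ∈ Nat.smoothNumbers (y + 1)
  · rw [Set.indicator_of_mem hS]
    have hnx : ¬ n ≤ ⌊x⌋₊ := fun h => hn (Nat.mem_smoothNumbersUpTo.mpr ⟨h, hS⟩)
    rw [twistWeight_of_not_mem, mul_zero]
    intro hmem
    have h2 : (n : ℝ) / x ≤ 1 := hmem.2
    rw [div_le_one hx] at h2
    exact hnx (Nat.le_floor h2)
  · rw [Set.indicator_of_notMem hS]

/-- The pointwise sum `∑_n F_n(t) = (2π)⁻¹ x^{σ+it} Ŵ_λ(σ+it) L(σ+it, χ; y)`. [folklore] -/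
theorem tsum_charMellinTerm {x σ : ℝ} (hx : 0 < x) (hσ : 0 < σ) (y : ℕ) (χ : DirichletCharacter ℂ q)
    (lam : ℝ) (t : ℝ) :
    ∑' n : ℕ, charMellinTerm x σ y χ lam n t =
      (1 / (2 * π) : ℝ) • ((x : ℂ) ^ ((σ : ℂ) + t * I) * twistMellin lam (σ + t * I) *
        smoothLC χ ((σ : ℂ) + t * I) y) := by
  unfold charMellinTerm
  rw [tsum_const_smul'']
  congr 1
  have hs : 0 < ((σ : ℂ) + t * I).re := by simp; exact hσ
  have hL := (hasSum_smoothLC χ hs y).tsum_eq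
  have hterm : ∀ n : ℕ, (Nat.smoothNumbers (y + 1)).indicator
      (fun m : ℕ => χ (m : ZMod q) * (((m / x : ℝ)) : ℂ) ^ (-((σ : ℂ) + t * I))) n * twistMellin lam (σ + t * I) =
      ((x : ℂ) ^ ((σ : ℂ) + t * I) * twistMellin lam (σ + t * I)) *
        (Nat.smoothNumbers (y + 1)).indicator (fun m : ℕ => χ (m : ZMod q) * (m : ℂ) ^ (-((σ : ℂ) + t * I))) n := by
    intro n
    by_cases hn : n ∈ Nat.smoothNumbers (y + 1)
    · rw [Set.indicator_of_mem hn, Set.indicator_of_mem hn]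
      have hn0 : 0 < n := Nat.pos_of_ne_zero (Nat.ne_zero_of_mem_smoothNumbers hn)
      rw [ofReal_div_cpow_neg (by exact_mod_cast hn0) hx]; push_cast; ring
    · rw [Set.indicator_of_notMem hn, Set.indicator_of_notMem hn]; ring
  simp_rw [hterm]
  rw [tsum_mul_left, hL]

/-- **The Mellin representation of the character-twisted weighted sum over smooth numbers**:
`∑_{n ∈ S(x,y)} χ(n) W_λ(n/x) = (2π)⁻¹ ∫ x^{σ+it} Ŵ_λ(σ+it) L(σ+it, χ; y) dt` (`x > 0`, `σ > 0`).
[cite: Harper2016, §2.2] [cite: HildebrandTenenbaum1986, §3] -/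
theorem sum_char_twistWeight_eq_integral {x σ : ℝ} (hx : 0 < x) (hσ : 0 < σ) (y : ℕ)
    (χ : DirichletCharacter ℂ q) (lam : ℝ) :
    ∑ n ∈ Nat.smoothNumbersUpTo ⌊x⌋₊ (y + 1), χ (n : ZMod q) * twistWeight lam (n / x) =
      (1 / (2 * π) : ℝ) • ∫ t : ℝ, (x : ℂ) ^ ((σ : ℂ) + t * I) * twistMellin lam (σ + t * I) *
        smoothLC χ ((σ : ℂ) + t * I) y := by
  have hC := hasSum_integral_of_summable_integral_norm (integrable_charMellinTerm hx hσ y χ lam)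
    (summable_integral_norm_charMellinTerm hx hσ y χ lam)
  simp_rw [integral_charMellinTerm hx hσ y χ lam] at hC
  have hB := hasSum_char_twistWeight hx y χ lam
  rw [hB.unique hC]
  simp_rw [tsum_charMellinTerm hx hσ y χ lam]
  rw [integral_smul]

/-! ### The decay of `L(σ+it, χ; y)` -/

/-- **The Euler factor with a twist**: for `p^σ ≥ 3/2` (e.g. `σ ≥ 3/5`) and `‖z‖ ≤ 1`,
`‖1 − z p^{−σ}‖⁻¹ ≤ (1 − p^{−σ})⁻¹ exp(−(1/5) p^{−σ} (1 − Re z))`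
(`‖1 − a z‖ ≥ 1 − a Re z = (1 − a)(1 + v)`, `v = a(1 − Re z)/(1−a) ≤ 4`, `(1+v)⁻¹ ≤ e^{−v/5}`).
[folklore] -/
theorem inv_norm_one_sub_mul_le {p : ℕ} (hp : 2 ≤ p) {σ : ℝ} (hσ : 3 / 5 ≤ σ) {z : ℂ} (hz : ‖z‖ ≤ 1) :
    ‖1 - z * (p : ℂ) ^ (-(σ : ℂ))‖⁻¹ ≤
      (1 - (p : ℝ) ^ (-σ))⁻¹ * Real.exp (-(1 / 5) * ((p : ℝ) ^ (-σ) * (1 - z.re))) := by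
  have hσ0 : 0 < σ := by linarith
  have hp0 : 0 < p := by omega
  have hp2r : (2 : ℝ) ≤ p := by exact_mod_cast hp
  have hp0r : (0 : ℝ) < p := by linarith
  set a : ℝ := (p : ℝ) ^ (-σ) with ha
  -- `a ≤ 2/3`
  have ha23 : a ≤ 2 / 3 := by
    have hP : (3 / 2 : ℝ) ≤ (p : ℝ) ^ σ := by
      calc (3 / 2 : ℝ) ≤ (2 : ℝ) ^ (3 / 5 : ℝ) := by
            by_contra h
            push Not at h
            have h0 : 0 ≤ (2 : ℝ) ^ (3 / 5 : ℝ) := by positivity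
            have h5 : ((2 : ℝ) ^ (3 / 5 : ℝ)) ^ 5 < (3 / 2 : ℝ) ^ 5 := pow_lt_pow_left₀ h h0 (by norm_num)
            have heq : ((2 : ℝ) ^ (3 / 5 : ℝ)) ^ 5 = 8 := by
              rw [← Real.rpow_natCast, ← Real.rpow_mul (by norm_num : (0 : ℝ) ≤ 2),
                show (3 / 5 : ℝ) * ((5 : ℕ) : ℝ) = ((3 : ℕ) : ℝ) by norm_num, Real.rpow_natCast]
              norm_num
            rw [heq] at h5
            norm_num at h5
        _ ≤ (2 : ℝ) ^ σ := Real.rpow_le_rpow_of_exponent_le one_le_two hσ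
        _ ≤ (p : ℝ) ^ σ := Real.rpow_le_rpow (by norm_num) hp2r hσ0.le
    rw [ha, Real.rpow_neg hp0r.le]
    rw [inv_le_comm₀ (by positivity) (by norm_num)]
    linarith
  have ha0 : 0 < a := Real.rpow_pos_of_pos hp0r _
  have h1a : 1 / 3 ≤ 1 - a := by linarith
  have hre1 : z.re ≤ 1 := le_trans (Complex.re_le_norm z) hz
  have hre1' : -1 ≤ z.re := by
    have h := (abs_le.mp (Complex.abs_re_le_norm z)).1
    linarith
  -- the complex factor: `(p : ℂ)^{-σ} = a`
  have hpa : (p : ℂ) ^ (-(σ : ℂ)) = (a : ℂ) := by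
    rw [ha, Complex.ofReal_cpow hp0r.le]; push_cast; ring_nf
  -- lower bound `‖1 − a z‖ ≥ 1 − a Re z`
  have hlow : 1 - a * z.re ≤ ‖1 - z * (p : ℂ) ^ (-(σ : ℂ))‖ := by
    rw [hpa]
    calc 1 - a * z.re = (1 - z * (a : ℂ)).re := by simp; ring
      _ ≤ ‖1 - z * (a : ℂ)‖ := Complex.re_le_norm _
  set v : ℝ := a * (1 - z.re) / (1 - a) with hv
  have hv0 : 0 ≤ v := by rw [hv]; apply div_nonneg (by nlinarith) (by linarith)
  have hv4 : v ≤ 4 := by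
    rw [hv, div_le_iff₀ (by linarith)]; nlinarith
  have hfac : 1 - a * z.re = (1 - a) * (1 + v) := by rw [hv]; field_simp; ring
  have hpos : 0 < 1 - a * z.re := by rw [hfac]; positivity
  -- `(1+v)⁻¹ ≤ exp(−v/5)`
  have hlog : v / 5 ≤ Real.log (1 + v) := by
    calc v / 5 ≤ v / (1 + v) := div_le_div_of_nonneg_left hv0 (by positivity) (by linarith)
      _ ≤ Real.log (1 + v) := by
          have h1 : 0 < 1 + v := by linarith
          have h := Real.log_le_sub_one_of_pos (inv_pos.2 h1)
          rw [Real.log_inv] at h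
          have : (1 + v)⁻¹ - 1 = -(v / (1 + v)) := by field_simp; ring
          linarith
  have hkey : (1 + v)⁻¹ ≤ Real.exp (-(v / 5)) := by
    calc (1 + v)⁻¹ ≤ (Real.exp (v / 5))⁻¹ := by
          apply inv_anti₀ (Real.exp_pos _)
          calc Real.exp (v / 5) ≤ Real.exp (Real.log (1 + v)) := Real.exp_le_exp.2 hlog
            _ = 1 + v := Real.exp_log (by positivity)
      _ = Real.exp (-(v / 5)) := by rw [Real.exp_neg]
  -- `exp(−v/5) ≤ exp(−a(1−Re z)/5)` since `v ≥ a(1 − Re z)`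
  have hva : a * (1 - z.re) ≤ v := by
    rw [hv, le_div_iff₀ (by linarith)]
    have h1 : 0 ≤ a * (1 - z.re) := by nlinarith
    nlinarith
  calc ‖1 - z * (p : ℂ) ^ (-(σ : ℂ))‖⁻¹ ≤ (1 - a * z.re)⁻¹ := inv_anti₀ hpos hlow
    _ = (1 - a)⁻¹ * (1 + v)⁻¹ := by rw [hfac, mul_inv]
    _ ≤ (1 - a)⁻¹ * Real.exp (-(v / 5)) := mul_le_mul_of_nonneg_left hkey (by positivity)
    _ ≤ (1 - a)⁻¹ * Real.exp (-(1 / 5) * (a * (1 - z.re))) := by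
        apply mul_le_mul_of_nonneg_left (Real.exp_le_exp.2 (by linarith)) (by positivity)

/-- **Decay of `L(σ+it, χ; y)`**: for `σ ≥ 3/5`,
`‖L(σ+it, χ; y)‖ ≤ ζ(σ, y) exp(−(1/5) ∑_{p ≤ y} p^{−σ} (1 − Re(χ(p) p^{−it})))`.
[cite: HildebrandTenenbaum1986, §3 Lemma 8] [cite: Harper2016, Appendix] -/
theorem norm_smoothLC_le_mul_exp (χ : DirichletCharacter ℂ q) {σ : ℝ} (hσ : 3 / 5 ≤ σ) (t : ℝ) (y : ℕ) :
    ‖smoothLC χ ((σ : ℂ) + t * I) y‖ ≤ smoothZeta σ y *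
      Real.exp (-(1 / 5) * ∑ p ∈ Nat.primesLE y,
        (p : ℝ) ^ (-σ) * (1 - (χ (p : ZMod q) * (p : ℂ) ^ (-((t : ℂ) * I))).re)) := by
  rw [smoothLC, smoothZeta, norm_prod, Finset.mul_sum, Real.exp_sum, ← Finset.prod_mul_distrib]
  refine Finset.prod_le_prod (fun p _ => norm_nonneg _) fun p hp => ?_
  have hp2 := (Nat.mem_primesLE.1 hp).2.two_le
  have hp0 : 0 < p := by omega
  rw [norm_inv]
  -- `χ(p) p^{-(σ+it)} = (χ(p) p^{-it}) p^{-σ}`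
  have hsplit : χ (p : ZMod q) * (p : ℂ) ^ (-((σ : ℂ) + t * I)) =
      (χ (p : ZMod q) * (p : ℂ) ^ (-((t : ℂ) * I))) * (p : ℂ) ^ (-(σ : ℂ)) := by
    rw [neg_add, Complex.cpow_add _ _ (by exact_mod_cast hp0.ne')]; ring
  rw [hsplit]
  have hz : ‖χ (p : ZMod q) * (p : ℂ) ^ (-((t : ℂ) * I))‖ ≤ 1 := by
    rw [norm_mul]
    have h1 : ‖(p : ℂ) ^ (-((t : ℂ) * I))‖ = 1 := by
      rw [Complex.norm_natCast_cpow_of_pos hp0]; simp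
    rw [h1, mul_one]; exact DirichletCharacter.norm_le_one χ _
  exact inv_norm_one_sub_mul_le hp2 hσ hz

end TwistedWeight

end Literature.NumberTheory.Sieve

end
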